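import Summits.QuantumFields.YangMills.Theorems.BalabanUVNodesN07LocalLettersSplitCore
import Summits.QuantumFields.YangMills.Theorems.BalabanUVNodesN07PureGaugeShiftLetters
import HarnessLib

/-!
# N07 [B11] (= [15] = [Balaban1985Variational]) Sect. F, road of record R0′, WIDTH-209 row (r2), FILE 4: **THE R0′ SPLIT CLAUSE `LocalGaugeSplitOn` OF THE S6 HEAD
# WITH THE SHIFT SUMMAND `G := H_V X` AND ITS CURL BINDER DISCHARGED** — dag-n07-w4's doors `localGaugeSplitOn_of_gauge152_eq159` ∕ `localGaugeSplitOn_of_eq159`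
# (p612069) composed BY NAME with FILE 3's «`H ∘ Q` preserves curl-freeness» and uniform-datum letters (p612997): in the S3 (152)-gauge form the shift needs NO
# letters of its own; in the (159) form its letters come from `Letters10On Y η_k t_G (H_V X)`; at NODE 00's four-tori from `‖X(c)‖ ≤ ς·L^{(K−n)−j(c)}`

Cell `pub-ymgap`, width seat `pub-ymgap-dag-n07-w8` g2, WIDTH-209 N07 row (r2) of road R0′ (TABLE v65 «(r2) n07-w8»); OFFER-1 of this seat (cell bus 2026-08-28 I.31074)
taken on the S6 head's word (dag-n07-w4 g3 I.≈31160: «YOURS, as v1.1 in your lineage after p612069 is built: compose … with my `localGaugeSplitOn_of_gauge152_eq159` or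
`localGaugeSplitOn_of_eq159`»; PLUG-CHECK I.≈31150).  `--kind proof --supports stmt-QuantumFields-20542 --as helper`; count-neutral; def-free; a NEW module (not an
append to p612997) because it imports the clause's home p612069.
[15] = T. Bałaban, *The variational problem and background fields in renormalization group method for lattice gauge theories*, Commun. Math. Phys. **102** (1985)
277–309 [Balaban1985Variational]; [6] = [Balaban1985RegularSpaces] (CMP **99** (1985) 75–102); [4] = [Balaban1984PropagatorsII] (CMP **96** (1984) 223–250);
[I.4] = [Balaban1984PropagatorsI] (CMP **95** (1984) 17–40).

THE PRINT.  [15] p. 301 (152): *«|A| , |∇^η A| … < O(1)·ε₀»* for the potential `A = (1∕iη) log U₁` of the gauged minimiser on `□̃`; p. 303 (159): *«A = A₁ + HB″ − HD(A₁ + HB″)»*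
(under road R0′ with the sheared datum: `A − ∂μ = A₁ + H(B″ + N) − HD(…)`, `∂μ = H(∂_cλ)` the shift summand — dag-n07-w7 `hOp_datum_split`); p. 304 (165)∕(168): the
three letters of `A` and the class (2) on `Δ₀` with `max{B₃ε₁, ½ε₀}`.  The S6 head's clause (dag-n07-w4 p612069 `LocalGaugeSplitOn Y ξ t t₀ U`): a gauge `u` with potential
`A₀ + G` on `Y`, `G` curl-free, `‖A₀ + G‖, ‖∇^ξ(A₀ + G)‖ < t`, `‖∇^ξA₀‖, ‖∂^{ξ*}∂^ξA₀‖ < t₀`.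

WHAT IS PROVED (sorry-free; no definition; axioms standard; all BY NAME).  `H_V` = the componentwise extension of k0-s1-w3's `flatH P k D` (kernel formula `hHV`, the head's
binder verbatim); the datum `X : 𝔅 → M_N(ℂ)`.
* §1 (generic `P : Params`, any lattice level `k`, any tower `D`) ★★ `localGaugeSplitOn_of_gauge152_componentwiseCurlFree` — S3 FORM: from S3's local gauge `u` of `U` on `Y`
  with potential `A` (gauge equation, `‖A‖ < t` on the bonds, `‖∇^{η_k}A‖ < t` on the derivative pairs: the (152) letters of the FULL potential), the (159)-splitting
  `A − H_V X = A₁ + A₂ − A₃` with `Letters10On Y η_k tᵢ Aᵢ` (i = 1, 2, 3), and a datum whose every real component is `QA′` of a curl-free fine real field `A′`: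
  `LocalGaugeSplitOn Y η_k t (t₁ + t₂ + t₃) U` (dag-n07-w4 `localGaugeSplitOn_of_gauge152_eq159` ∘ FILE 3 `curlA_extension_eq_zero_of_componentwise_curlFree`) — in this
  form the shift needs NO letters of its own, (152) sizes the full potential; instances ★★ `localGaugeSplitOn_of_gauge152_coarsePureGauge` (`X = Q(∂^{Lᵏ}M)`, `M` a fine
  matrix gauge function — road R0′'s `∂_cλ`, `λ_j = Q′_jM`) and `localGaugeSplitOn_of_gauge152_curlFreeFine` (`X = QA_f`, `∂^{Lᵏ}A_f = 0`); ★
  `localGaugeSplitOn_of_eq159_coarsePureGauge` — (159) FORM: gauge equation for `A₀ + H_V X`, `A₀ = A₁ + A₂ − A₃` with the three `Letters10On`, `X = Q(∂^{Lᵏ}M)`, and the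
  shift's own letters `Letters10On Y η_k t_G (H_V X)` ⇒ `LocalGaugeSplitOn Y η_k (t₁ + t₂ + t₃ + t_G) (t₁ + t₂ + t₃) U` (dag-n07-w4 `localGaugeSplitOn_of_eq159` ∘ FILE 3
  `curlA_extension_eq_zero_of_bondAvgIter_grad`).
* §2 (NODE 00's four-tori) ★★ `localGaugeSplitOn_of_eq159_uniformDatum_adm22_T4 F N` — §1's (159) form ∘ FILE 3 §2 `letters10On_extension_of_uniformDatum_adm22_T4`: for every
  admissible tower (`Adm22`), window `Y` of top-level sites and datum `X = Q(∂^{Lᵏ}M)` with `‖X(c)‖ ≤ ς·L^{(K−n)−j(c)}` at every cell, the clause holds at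
  `(t₁ + t₂ + t₃ + t_G, t₁ + t₂ + t₃)` for every `t_G > 2CB₃ς` (`C`, `B₃` the S5 socket's constants) — NO collar, NO (163′) for the shift summand.
HONEST SCOPE.  Count-neutral kernel bookkeeping: ∃-packaging of the head's doors with FILE 3's theorems, nothing else.  DISPLAYED, not discharged: S3's gauge and (152) letters,
the (159)-splitting and the three summands' letters (S4∕S5∕piece 4∕Prop. 6 rows), the datum's `Q(ker ∂)` form (LOCATED-QFORM, cell bus I.31074) and size `ς` ((r4)∕(r4-rec)),
P12's tower∕window hypotheses.  Nothing of [15]∕[6]∕[4] ANALYSIS asserted; the tokens `LocalLettersSplitTopStepCore` ∕ `DatumGaugeSplitTopStepCore` ∕ `HalvingStepTop(Core)` ∕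
`stub_prop8StepCoP13` are NOT discharged; K0⁷ ∕ K1⁷ NOT closed; N07 NOT discharged; counts unmoved (typed 28∕28 · discharged 5∕27); one finite 𝕋⁴ programme at fixed ε —
R4-the-rung closes the conditional finite-𝕋⁴ `BalabanLadder.UV` ONLY; the YM mass gap (Clay) is NOT proved by any of this; nothing continuum ∕ ℝ⁴ ∕ OS.  No `sorry`, no `def`,
no `instance`, no `notation`.

RELATED IN THE TREE, NOT DUPLICATED (stem check 2026-08-28T07:44Z: `ls …/Theorems | grep -i 'SplitClauseOfPureGaugeShift\|SplitOfShift\|ClauseOfShift'` = ∅; `rg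
'localGaugeSplitOn_of_gauge152_coarsePureGauge|localGaugeSplitOn_of_eq159_coarsePureGauge|localGaugeSplitOn_of_gauge152_componentwise|localGaugeSplitOn_of_eq159_uniformDatum'`
= ∅): dag-n07-w4's `N07LocalLettersSplitCore` (the clause, its doors with `G` and `hG` as BINDERS, the tokens and threshold arithmetic — CONSUMED) and FILE 3
`N07PureGaugeShiftLetters` (the curl binder and letters of `H_V X` — CONSUMED); g0's `N07PureGaugeShift168` (the class-(2) kernel behind the clause).

References: [15] (152) p. 301, (157)–(159) pp. 302–303, (164)–(165) p. 304, (168) p. 304, p. 288; [6] (1.2) p. 76, (1.7)–(1.9) p. 77, (1.54) p. 85; [4] (2.5) p. 224,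
(2.35) p. 228, (2.60) p. 234; [I.4] (1.18)–(1.20) p. 20.
-/

set_option autoImplicit false

noncomputable section
open scoped BigOperators Matrix.Norms.L2Operator

namespace Summit.QuantumFields.YangMills.BalabanUVNodes.N07SplitClauseOfPureGaugeShift

open Literature.MathematicalPhysics.QuantumFieldTheory.Balaban1983to89
open Literature.MathematicalPhysics.QuantumFieldTheory.Balaban1983to89.Node00
open Literature.MathematicalPhysics.QuantumFieldTheory.Balaban1983to89.B15DeterminingSets
open Literature.MathematicalPhysics.QuantumFieldTheory.Balaban1983to89.B12RegularSpaces111 (gaugeU expI grad)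
open LatticeFieldCalculus (curl bondAvgIter)
open B6SectADomainsV1 (Domains)
open B6SectAOperatorsV1 (ScalarSpace BondIdx dE dcE QE)
open T4Continuum (T4Family)
open Literature.MathematicalPhysics.QuantumFieldTheory.BalabanImbrieJaffe1984to88.BIJ85AxialPropagator411 (BondSpace)
open Summit.QuantumFields.YangMills.Theorems.FlatCubeOpsText (Adm22)
open Summit.QuantumFields.YangMills.Theorems.K0FlatCubeOpsTextP (flatH IsLevWeight)
open Summit.QuantumFields.YangMills.BalabanUVNodes.N07HalvingStepTopOfLocalLetters (Letters10On)
open Summit.QuantumFields.YangMills.BalabanUVNodes.N07LocalLettersSplitCore (LocalGaugeSplitOn localGaugeSplitOn_of_gauge152_eq159 localGaugeSplitOn_of_eq159)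
open Summit.QuantumFields.YangMills.BalabanUVNodes.N07PureGaugeShiftLetters (curlA_extension_eq_zero_of_componentwise_curlFree
  componentwise_of_bondAvgIter_grad componentwise_curlFree_of_bondAvgIter_curlFree curlA_extension_eq_zero_of_bondAvgIter_grad
  letters10On_extension_of_uniformDatum_adm22_T4)
open B6SectACriticalPointV1 (dcE_comp_dE)

variable {P : Params} {N : ℕ}

/-! ## §1  The clause with `G := H_V X`, generic carrier -/

section Generic

variable {k : ℕ} {D : Domains P}

open scoped Classical in
/-- ★★ **THE R0′ SPLIT CLAUSE FROM S3's (152)-GAUGE OF THE FULL POTENTIAL, SHIFT `G := H_V X` WITH `X` COMPONENTWISE `Q(ker ∂)`** — dag-n07-w4's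
`localGaugeSplitOn_of_gauge152_eq159` with its `hG` binder discharged by FILE 3's `curlA_extension_eq_zero_of_componentwise_curlFree`: S3's local gauge `u` of `U` on `Y`
with potential `A` (`he`), the (152) letters `‖A‖ < t` on the bonds and `‖∇^{η_k}A‖ < t` on the derivative pairs, the (159)-splitting `A − H_V X = A₁ + A₂ − A₃` with
`Letters10On` letters `t₁, t₂, t₃`, and a datum whose every real component is `QA′` for some curl-free fine real `A′` ⇒ `LocalGaugeSplitOn Y η_k t (t₁ + t₂ + t₃) U`.  In
this form the shift summand needs NO letters of its own. [cite: Balaban1985Variational, (152) p.301, (157)–(159) pp.302–303, (165) p.304, (168) p.304; Balaban1984PropagatorsII, (2.35) p.228; Balaban1985RegularSpaces, (1.2) p.76] -/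
theorem localGaugeSplitOn_of_gauge152_componentwiseCurlFree {Y : Set (Site P 0)} {t t₁ t₂ t₃ : ℝ} {U : GaugeField P 0 (SU N)}
    (u : GaugeTransf P 0 (SU N)) {A A₁ A₂ A₃ : PBond P 0 → MatA N}
    {HV : (BondIdx D → MatA N) →ₗ[ℂ] (PBond P 0 → MatA N)}
    (hHV : ∀ (B : BondIdx D → MatA N) (b : PBond P 0), HV B b = ∑ c, ((flatH P k D (Pi.single c 1) b : ℝ) : ℂ) • B c)
    {X : BondIdx D → MatA N}
    (hX : ∀ (f : StrongDual ℂ (MatA N)) (v : ℂ) (r : ℝ), ∃ A' : BondSpace P,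
      dcE ((P.L : ℝ) ^ k) A' = 0 ∧ (fun c => r * (v * f (X c)).re) = WithLp.ofLp (QE D A'))
    (he : ∀ b ∈ (Sect2.regionOfSet P Y).bonds, gaugeU (fun x => ιSU N (u x)) (fun b' => ιSU N (U b')) b = expI (P.eta k) (A b))
    (hA : ∀ b ∈ (Sect2.regionOfSet P Y).bonds, ‖A b‖ < t)
    (hdA : ∀ q ∈ (Sect2.regionOfSet P Y).dpairs, ‖grad (P.eta k) q.2.1 (fun y => A ⟨y, q.2.2⟩) q.1‖ < t)
    (h159 : ∀ b, A b - HV X b = A₁ b + A₂ b - A₃ b)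
    (h₁ : Letters10On Y (P.eta k) t₁ A₁) (h₂ : Letters10On Y (P.eta k) t₂ A₂) (h₃ : Letters10On Y (P.eta k) t₃ A₃) :
    LocalGaugeSplitOn Y (P.eta k) t (t₁ + t₂ + t₃) U :=
  localGaugeSplitOn_of_gauge152_eq159 u he hA hdA (curlA_extension_eq_zero_of_componentwise_curlFree hHV hX) h159 h₁ h₂ h₃

open scoped Classical in
/-- ★★ **THE SAME FOR ROAD R0′'s DATUM `X = Q(∂^{Lᵏ}M)`** (`M` a fine matrix gauge function; by [I.4] (1.20) `X` is the coarse pure gauge `∂^{(j)}(Q′_jM)` = `∂_cλ`,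
`λ_j = Q′_jM`): `LocalGaugeSplitOn Y η_k t (t₁ + t₂ + t₃) U` from S3's (152)-gauge and the (159)-splitting `A − H_V X = A₁ + A₂ − A₃`.
[cite: Balaban1985Variational, (152) p.301, (157)–(159) pp.302–303, (165) p.304; Balaban1984PropagatorsI, (1.20) p.20; Balaban1984PropagatorsII, (2.35) p.228] -/
theorem localGaugeSplitOn_of_gauge152_coarsePureGauge {Y : Set (Site P 0)} {t t₁ t₂ t₃ : ℝ} {U : GaugeField P 0 (SU N)}
    (u : GaugeTransf P 0 (SU N)) {A A₁ A₂ A₃ : PBond P 0 → MatA N}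
    {HV : (BondIdx D → MatA N) →ₗ[ℂ] (PBond P 0 → MatA N)}
    (hHV : ∀ (B : BondIdx D → MatA N) (b : PBond P 0), HV B b = ∑ c, ((flatH P k D (Pi.single c 1) b : ℝ) : ℂ) • B c)
    {X : BondIdx D → MatA N} (M : Site P 0 → MatA N)
    (hXM : ∀ c : BondIdx D, X c = bondAvgIter (c.1.1 : ℕ) (LatticeFieldCalculus.grad ((P.L : ℝ) ^ k) M) c.1.2)
    (he : ∀ b ∈ (Sect2.regionOfSet P Y).bonds, gaugeU (fun x => ιSU N (u x)) (fun b' => ιSU N (U b')) b = expI (P.eta k) (A b))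
    (hA : ∀ b ∈ (Sect2.regionOfSet P Y).bonds, ‖A b‖ < t)
    (hdA : ∀ q ∈ (Sect2.regionOfSet P Y).dpairs, ‖grad (P.eta k) q.2.1 (fun y => A ⟨y, q.2.2⟩) q.1‖ < t)
    (h159 : ∀ b, A b - HV X b = A₁ b + A₂ b - A₃ b)
    (h₁ : Letters10On Y (P.eta k) t₁ A₁) (h₂ : Letters10On Y (P.eta k) t₂ A₂) (h₃ : Letters10On Y (P.eta k) t₃ A₃) :
    LocalGaugeSplitOn Y (P.eta k) t (t₁ + t₂ + t₃) U :=
  localGaugeSplitOn_of_gauge152_eq159 u he hA hdA (curlA_extension_eq_zero_of_bondAvgIter_grad hHV M hXM) h159 h₁ h₂ h₃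

open scoped Classical in
/-- **THE SAME FOR A DATUM `X = QA_f` OF A CURL-FREE FINE MATRIX FIELD `A_f`** (`∂^{Lᵏ}A_f = 0`: pure gauges plus constant one-forms on the torus).
[cite: Balaban1985Variational, (152) p.301, (159) p.303, (165) p.304, (168) p.304; Balaban1984PropagatorsI, (1.18) p.20; Balaban1984PropagatorsII, (2.35) p.228] -/
theorem localGaugeSplitOn_of_gauge152_curlFreeFine {Y : Set (Site P 0)} {t t₁ t₂ t₃ : ℝ} {U : GaugeField P 0 (SU N)}
    (u : GaugeTransf P 0 (SU N)) {A A₁ A₂ A₃ : PBond P 0 → MatA N}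
    {HV : (BondIdx D → MatA N) →ₗ[ℂ] (PBond P 0 → MatA N)}
    (hHV : ∀ (B : BondIdx D → MatA N) (b : PBond P 0), HV B b = ∑ c, ((flatH P k D (Pi.single c 1) b : ℝ) : ℂ) • B c)
    {X : BondIdx D → MatA N} (Af : PBond P 0 → MatA N) (hAf : ∀ p : Plaq P 0, curl ((P.L : ℝ) ^ k) Af p = 0)
    (hXA : ∀ c : BondIdx D, X c = bondAvgIter (c.1.1 : ℕ) Af c.1.2)
    (he : ∀ b ∈ (Sect2.regionOfSet P Y).bonds, gaugeU (fun x => ιSU N (u x)) (fun b' => ιSU N (U b')) b = expI (P.eta k) (A b))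
    (hA : ∀ b ∈ (Sect2.regionOfSet P Y).bonds, ‖A b‖ < t)
    (hdA : ∀ q ∈ (Sect2.regionOfSet P Y).dpairs, ‖grad (P.eta k) q.2.1 (fun y => A ⟨y, q.2.2⟩) q.1‖ < t)
    (h159 : ∀ b, A b - HV X b = A₁ b + A₂ b - A₃ b)
    (h₁ : Letters10On Y (P.eta k) t₁ A₁) (h₂ : Letters10On Y (P.eta k) t₂ A₂) (h₃ : Letters10On Y (P.eta k) t₃ A₃) :
    LocalGaugeSplitOn Y (P.eta k) t (t₁ + t₂ + t₃) U :=
  localGaugeSplitOn_of_gauge152_componentwiseCurlFree u hHV (componentwise_curlFree_of_bondAvgIter_curlFree Af hAf hXA) he hA hdA h159 h₁ h₂ h₃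

open scoped Classical in
/-- ★ **THE R0′ SPLIT CLAUSE IN THE (159) FORM** — dag-n07-w4's `localGaugeSplitOn_of_eq159` with `G := H_V X`, `X = Q(∂^{Lᵏ}M)`, the `hG` binder discharged by FILE 3 and
the shift's two letters taken from `Letters10On Y η_k t_G (H_V X)` (whose four-torus inhabitant is FILE 3's `letters10On_extension_of_uniformDatum_adm22_T4`): the gauge
equation for `A₀ + H_V X` on `Y`, `A₀ = A₁ + A₂ − A₃` with `Letters10On` letters `t₁, t₂, t₃` ⇒ `LocalGaugeSplitOn Y η_k (t₁ + t₂ + t₃ + t_G) (t₁ + t₂ + t₃) U`.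
[cite: Balaban1985Variational, (157)–(159) pp.302–303, (164)–(165) p.304, (168) p.304; Balaban1984PropagatorsI, (1.20) p.20; Balaban1984PropagatorsII, (2.35) p.228] -/
theorem localGaugeSplitOn_of_eq159_coarsePureGauge {Y : Set (Site P 0)} {t₁ t₂ t₃ tG : ℝ} {U : GaugeField P 0 (SU N)}
    (u : GaugeTransf P 0 (SU N)) {A₀ A₁ A₂ A₃ : PBond P 0 → MatA N}
    {HV : (BondIdx D → MatA N) →ₗ[ℂ] (PBond P 0 → MatA N)}
    (hHV : ∀ (B : BondIdx D → MatA N) (b : PBond P 0), HV B b = ∑ c, ((flatH P k D (Pi.single c 1) b : ℝ) : ℂ) • B c)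
    {X : BondIdx D → MatA N} (M : Site P 0 → MatA N)
    (hXM : ∀ c : BondIdx D, X c = bondAvgIter (c.1.1 : ℕ) (LatticeFieldCalculus.grad ((P.L : ℝ) ^ k) M) c.1.2)
    (he : ∀ b ∈ (Sect2.regionOfSet P Y).bonds, gaugeU (fun x => ιSU N (u x)) (fun b' => ιSU N (U b')) b = expI (P.eta k) ((A₀ + HV X) b))
    (hA₀ : ∀ b, A₀ b = A₁ b + A₂ b - A₃ b)
    (h₁ : Letters10On Y (P.eta k) t₁ A₁) (h₂ : Letters10On Y (P.eta k) t₂ A₂) (h₃ : Letters10On Y (P.eta k) t₃ A₃)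
    (hGL : Letters10On Y (P.eta k) tG (HV X)) :
    LocalGaugeSplitOn Y (P.eta k) (t₁ + t₂ + t₃ + tG) (t₁ + t₂ + t₃) U :=
  localGaugeSplitOn_of_eq159 u he (curlA_extension_eq_zero_of_bondAvgIter_grad hHV M hXM) hA₀ h₁ h₂ h₃ hGL.1 hGL.2.1

end Generic

/-! ## §2  The (159) form on NODE 00's four-tori, the shift's letters from the level-uniform datum size -/

section T4

open scoped Classical in
/-- ★★ **THE R0′ SPLIT CLAUSE AT NODE 00's OBJECTS, SHIFT LETTERS FROM THE UNIFORM DATUM SIZE** — §1's (159) form ∘ FILE 3 §2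
`letters10On_extension_of_uniformDatum_adm22_T4`: there are `M_h⁰, R₀` and `C ≥ 0`, `δ₀, δ₁, B₃ > 0` (the S5 socket's) such that for every height `1 ≤ K − n`, sizes, every
admissible tower `D` (`Adm22`) with its level weights, every window `Y` of top-level sites, every componentwise extension `H_V` of `flatH`, every datum `X = Q(∂^{Lᵏ}M)`
(`k = K − n`) with `‖X(c)‖ ≤ ς·L^{(K−n)−j(c)}` at every cell, every gauge `u` with potential `A₀ + H_V X` on `Y` at the unit `η_{K−n}` and `A₀ = A₁ + A₂ − A₃` with
`Letters10On` letters `t₁, t₂, t₃`: `LocalGaugeSplitOn Y η_{K−n} (t₁ + t₂ + t₃ + t_G) (t₁ + t₂ + t₃) U` for EVERY `t_G > 2CB₃ς` — no collar, no (163′) for the shift.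
[cite: Balaban1985Variational, (152) p.301, (157)–(159) pp.302–303, (161) p.303, (164)–(165) p.304, (168) p.304; Balaban1984PropagatorsII, (2.35) p.228, (2.60) p.234, Cor. 2.8 (2.150)–(2.151) p.249; Balaban1984PropagatorsI, (1.20) p.20] -/
theorem localGaugeSplitOn_of_eq159_uniformDatum_adm22_T4 (F : T4Family) (N : ℕ) [NeZero N] :
    ∃ (Mh₀ R₀ : ℕ) (C δ₀ δ₁ B₃ : ℝ), 0 ≤ C ∧ 0 < δ₀ ∧ 0 < δ₁ ∧ 0 < B₃ ∧
    ∀ (n K : ℕ) (_ : 1 ≤ K - n) (_ : K - n + 1 ≤ F.m + K) {Mh R a' : ℕ} (_ : Mh = F.L ^ a') (_ : Mh₀ ≤ Mh) (_ : R₀ ≤ R) (_ : a' + 3 ≤ F.m + n)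
      (D : Domains (F.P K)) (_ : D.k = K - n) (_ : Adm22 D R (F.L * Mh))
      (w : ℕ → PBond (F.P K) 0 → ℝ) (_ : IsLevWeight (F.P K) (K - n) D w)
      {Y : Set (Site (F.P K) 0)} (_ : ∀ x ∈ Y, D.InOm (K - n) x)
      {HV : (BondIdx D → MatA N) →ₗ[ℂ] (PBond (F.P K) 0 → MatA N)}
      (_ : ∀ (B : BondIdx D → MatA N) (b : PBond (F.P K) 0), HV B b = ∑ c, ((flatH (F.P K) (K - n) D (Pi.single c 1) b : ℝ) : ℂ) • B c)
      {X : BondIdx D → MatA N} (M : Site (F.P K) 0 → MatA N)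
      (_ : ∀ c : BondIdx D, X c = bondAvgIter (c.1.1 : ℕ) (LatticeFieldCalculus.grad (((F.P K).L : ℝ) ^ (K - n)) M) c.1.2)
      {ς : ℝ} (_ : 0 ≤ ς) (_ : ∀ c : BondIdx D, ‖X c‖ ≤ ς * ((F.P K).L : ℝ) ^ ((K - n) - (c.1.1 : ℕ)))
      {U : GaugeField (F.P K) 0 (SU N)} (u : GaugeTransf (F.P K) 0 (SU N)) {A₀ A₁ A₂ A₃ : PBond (F.P K) 0 → MatA N} {t₁ t₂ t₃ : ℝ}
      (_ : ∀ b ∈ (Sect2.regionOfSet (F.P K) Y).bonds,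
        gaugeU (fun x => ιSU N (u x)) (fun b' => ιSU N (U b')) b = expI ((F.P K).eta (K - n)) ((A₀ + HV X) b))
      (_ : ∀ b, A₀ b = A₁ b + A₂ b - A₃ b)
      (_ : Letters10On Y ((F.P K).eta (K - n)) t₁ A₁) (_ : Letters10On Y ((F.P K).eta (K - n)) t₂ A₂) (_ : Letters10On Y ((F.P K).eta (K - n)) t₃ A₃)
      {tG : ℝ} (_ : 2 * C * B₃ * ς < tG),
      LocalGaugeSplitOn Y ((F.P K).eta (K - n)) (t₁ + t₂ + t₃ + tG) (t₁ + t₂ + t₃) U := by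
  obtain ⟨Mh₀, R₀, C, δ₀, δ₁, B₃, hC, hδ₀, hδ₁, hB₃, hmain⟩ := letters10On_extension_of_uniformDatum_adm22_T4 F N
  refine ⟨Mh₀, R₀, C, δ₀, δ₁, B₃, hC, hδ₀, hδ₁, hB₃, ?_⟩
  intro n K hk1 hk' Mh R a' hMha hMh hR hsize D hDk hAdm w hw Y hY HV hHV X M hXM ς hς hXς U u A₀ A₁ A₂ A₃ t₁ t₂ t₃ he hA₀ h₁ h₂ h₃ tG htG
  have hGL : Letters10On Y ((F.P K).eta (K - n)) tG (HV X) :=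
    hmain n K hk1 hk' hMha hMh hR hsize D hDk hAdm w hw hY hHV hς hXς htG
  exact localGaugeSplitOn_of_eq159_coarsePureGauge u hHV M hXM he hA₀ h₁ h₂ h₃ hGL

end T4

end Summit.QuantumFields.YangMills.BalabanUVNodes.N07SplitClauseOfPureGaugeShift

end
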